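import Summits.MatrixMultiplication.MatrixMultiplication.Theses.DesignFlattening

/-!
# MatrixMultiplication / DesignFlattening — `SeparableExit` (stmt-MatrixMultiplication-8041)

Route `DesignFlattening`, support glue `SeparableExit : ¬ SingleBlockSeparableFloor → GrowingHostDesigns`
(the separable exit). `SingleBlockSeparableFloor` claims a uniform `δ > 0` such that every separable
`k`-term toric design `∑ⱼ ⊗ᵢ U_G ∘ (u_{ji} ⊗ v_{ji} ⊗ w_{ji})` of the `N`-th power of a punctured table
`[b + c = a ∧ (b,c) ∈ P]` hosting `⟨m,m,m⟩` on the nose costs `|G|^N · k ≥ (m^{2+δ})^N`. Its negation,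
instantiated at `δ := η`, hands us a hosting `(G, P, m, α, β, γ)` and a separable design
`(N, k, u, v, w)` with `|G|^N · k < (m^{2+η})^N`; we repackage it as the data of `GrowingHostDesigns`:

* `p = 1` block: on `Σ _ : Fin 1, Fin m × Fin m` the direct sum `1 ⊙ ⟨m,m,m⟩` is `⟨m,m,m⟩`
  (`matMulDirectSum_block`), hosted by `α ∘ Sigma.snd` etc.;
* `N ≥ 1`: for `N = 0` the violating inequality forces `k = 0`, and a `0`-term design of the `0`-th
  power is impossible (`kroneckerPow_zero`: the empty Kronecker power is the scalar `1 ≠ 0`);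
* the completion `S := ∑ⱼ (⊗ᵢ u_{ji}) ⊗ (⊗ᵢ v_{ji}) ⊗ (⊗ᵢ w_{ji})` is a sum of `k` triads, so
  `R(S) ≤ k` (`tensorRank_le_of_eq_sum`), and `U_G^{⊗N} ∘ S` is the design entrywise;
* cost: `|G|^N · R(S) ≤ |G|^N · k < (m^{2+η})^N = (1 · m^{2+η})^N`.

Sources: Coppersmith–Winograd 1990 §11 (twist-and-average designs); Bläser 2013 §4, §7 (rank,
direct sums).
-/

-- the tree's namespace `Summit.MatrixMultiplication.MatrixMultiplication.…` repeats a component by design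
set_option linter.dupNamespace false

namespace Summit.MatrixMultiplication.MatrixMultiplication.Theorems

open scoped BigOperators
open Summit.MatrixMultiplication.MatrixMultiplication.Theses.DesignFlattening
open Literature.Computability.AlgebraicComplexity

/-- **Glue `SeparableExit`** (route DesignFlattening, stmt-MatrixMultiplication-8041):
`¬ SingleBlockSeparableFloor → GrowingHostDesigns`. Given `η > 0`, the failure of the single-block
separable floor at `δ := η` is a punctured abelian hosting of `⟨m,m,m⟩` (`m ≥ 2`) together with a
separable `k`-term toric design of the `N`-th power of the punctured table with
`|G|^N · k < (m^{2+η})^N`; then `N ≥ 1` (a `0`-term design of the `0`-th power would give `1 = 0`),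
`p := 1` (one block, `matMulDirectSum_block`), and the separable completion
`S := ∑ⱼ (⊗ᵢ u_{ji}) ⊗ (⊗ᵢ v_{ji}) ⊗ (⊗ᵢ w_{ji})` has `R(S) ≤ k` and `U_G^{⊗N} ∘ S` equal to the
design, so `|G|^N · R(S) ≤ |G|^N · k < (1 · m^{2+η})^N`. -/
theorem separableExit_proof :
    Summit.MatrixMultiplication.MatrixMultiplication.Theses.DesignFlattening.SeparableExit := by
  unfold SeparableExit SingleBlockSeparableFloor GrowingHostDesigns
  intro hneg η hη
  push Not at hneg
  obtain ⟨G, iG, iF, iD, P, m, α, β, γ, hm, hhost, N, k, u, v, w, hdesign, hlt⟩ := hneg η hη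
  -- `N ≥ 1`: a `0`-term design of the `0`-th power is impossible
  have hN : 1 ≤ N := by
    rcases Nat.eq_zero_or_pos N with rfl | hpos
    · exfalso
      have hk1 : (k : ℝ) < 1 := by simpa using hlt
      have hk : k = 0 := by exact_mod_cast Nat.lt_one_iff.mp (by exact_mod_cast hk1)
      subst hk
      have h0 := hdesign (fun i => Fin.elim0 i) (fun i => Fin.elim0 i) (fun i => Fin.elim0 i)
      rw [kroneckerPow_zero] at h0
      simp at h0
    · exact hpos
  -- the separable completion `S`, a sum of `k` triads
  set S : (Fin N → G) → (Fin N → G) → (Fin N → G) → ℂ :=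
    ∑ j, triad (fun a => ∏ i, u j i (a i)) (fun b => ∏ i, v j i (b i)) (fun c => ∏ i, w j i (c i))
    with hS
  have hRS : tensorRank S ≤ k := tensorRank_le_of_eq_sum _ _ _ hS
  refine ⟨G, iG, iF, iD, P, 1, m, N, le_rfl, hm, hN,
    ⟨fun x => α x.2, fun y => β y.2, fun z => γ z.2, ?_⟩, S, ?_, ?_⟩
  · -- one block: `1 ⊙ ⟨m,m,m⟩ = ⟨m,m,m⟩`, hosted by `α, β, γ` through the second component
    rintro ⟨i, x⟩ ⟨j, y⟩ ⟨l, z⟩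
    have hj : j = i := Subsingleton.elim _ _
    have hl : l = i := Subsingleton.elim _ _
    subst hj hl
    rw [matMulDirectSum_block]
    exact hhost x y z
  · -- `U_G^{⊗N} ∘ S` is the design, entrywise
    intro a b c
    rw [hdesign a b c, kroneckerPow_apply, hS]
    simp only [Finset.sum_apply, triad_apply, Finset.mul_sum]
    refine Finset.sum_congr rfl fun j _ => ?_
    simp only [Finset.prod_mul_distrib]
    ring
  · -- cost: `|G|^N · R(S) ≤ |G|^N · k < (m^{2+η})^N = (1 · m^{2+η})^N`
    have hle : (Fintype.card G : ℝ) ^ N * (tensorRank S : ℝ) ≤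
        (Fintype.card G : ℝ) ^ N * (k : ℝ) :=
      mul_le_mul_of_nonneg_left (by exact_mod_cast hRS) (by positivity)
    have hlt' : (Fintype.card G : ℝ) ^ N * (k : ℝ) < (((1 : ℕ) : ℝ) * (m : ℝ) ^ (2 + η)) ^ N := by
      simpa using hlt
    exact (hle.trans_lt hlt').le

end Summit.MatrixMultiplication.MatrixMultiplication.Theorems
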